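import Summits.QuantumFields.BalabanUV.T4Continuum.Support.B13HistInsertionLoc
import Summits.QuantumFields.BalabanUV.T4Continuum.Support.B13StepEndArithmetic
import Summits.QuantumFields.BalabanUV.T4Continuum.Support.B13StepEndOn

/-!
# B13StepEndKernelLoc — NE5 ∕ U3: the END face of record E1 (`B13StepEnd.ne5_of_assembly` at `B13StepOfRecord.assembly S`) and its
# η-UNIFORM form (`B13StepEndArithmetic.uniform_ne5_of_record`) for a slot package whose insertion datum is READ FROM A FINITE-RANK
# KERNEL DATUM over a sup-normed table space, with the three insertion binders — run A's slice budget `hbA` (W3), run B's slice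
# budget `hbB` (leaf L03's input) and W4 `InsertionRate` — DISCHARGED BY NAME from PER-ENTRY kernel budgets ∕ base rate ∕ kernel rate
# (`B13HistInsertionLoc` §2–§5; owner ruling R22's reading of the constants `cA`, `cB`, `δv`: per entry, volume-uniform)
# (cell `pub-balaban`, T⁴ fan-out, `HOME/BINDER-OWNERS.md` row NE5; unit `b2b-balaban-t4-ne5-formalise-leaf-04`, gen 2; journal INTENT l.12279)

HONEST FRAMING (T4-DAG PAGE 1).  Rung (B)+1 on ONE finite four-torus of fixed physical size — NOT infinite volume, NOT a mass gap, NOT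
the Clay problem; `FlowStep.BetaPertH`, (B), (B^μ) do not occur here.  NE5 (`T4OutputRate.NE5`) is NOT PRINTED and NOT PROVED (spine
0/9, unchanged): this module is an IMPLICATION from displayed binders, exactly like the END faces it applies; it instantiates NO leaf
on Bałaban's concrete kernels ∕ potentials ∕ terms.  Nothing of the manuscripts under audit is asserted; 0 cite tags; no claim that
Bałaban's insertion (1.33) is finite-rank (MODELLING NOTE of `B13HistInsertion`).  HONEST DEPENDENCY (cell, verbatim): continuum YM on
T⁴ ⇐ BetaPertH ∧ nine spine estimates (0/9 proved); BetaPertH ⇐ (D1) ∧ (D4) ∧ CAP+tail; G-an2-4 gates asym, D1 and NE2/3/4.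

WHAT THIS MODULE IS (an APPLICATION of three landed END faces BY NAME in a new module — pattern of `B13StepEnd` N45 ∕ `B13StepSecantEnd`
N66 ∕ `B13StepOfRecordSecantEnd` N74 ∕ `B13StepEnvelopeEnd` N116; no END face of record is edited or restated):
* `ne5_of_record_kernel_eval` — for `S : B13StepOfRecord.Slots R E IOp (α →ᵇ ℂ)` and `K : B13HistInsertion.KernelDatum R.carriers IOp
  (α →ᵇ ℂ)` with `S.D = K.toInsDatum` (the insertion datum of the slot package IS the finite-rank kernel datum; the history space is
  a space of bounded tables with the SUP norm — the KIND of the Hist of record `B13HistDatum.Hist F = Entry F →ᵇ ℂ`): E1[B13]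
  `B13StepEnd.ne5_of_assembly (assembly S)` with
  `hbA := sliceBudget_of_kerBudgetLoc norming_evalCLM` (⟸ `KerBudgetLoc K (step S E₀ cB) W κ cA evalCLM`),
  `hbB :=` the body of `SliceBudgetB` by `norm_sliceB_le_of_kerBudgetBLoc norming_evalCLM` (⟸ `KerBudgetBLoc K (step S E₀ cB) W κ cB evalCLM`),
  `hins := insertionRate_of_kernelRates_eval` (⟸ the displayed NE2-TYPE `BaseRate K.linA (linB K) (step S E₀ cB) W δb θ` and
  `KerRateLoc K (step S E₀ cB) W κ δv θ evalCLM`; W4 constant `δ′ := δb + E₀·δv(1 − ω)⁻¹`), the readings `ReadsA`∕`ReadsB` by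
  `step_insA`∕`step_insB` + `S.D = K.toInsDatum`; EVERY OTHER binder of E1 VERBATIM and in E1's order (transport reading, the two
  levels L05∕L06, W1 in row NE2's entry currency + floor, termwise W2 data on the budget-box class, rooms, numerics L10∕L11);
  conclusion LITERALLY `NE5 (outA S E₀ cB) (outB S E₀ cB) W κ θ′ (E1's constant with δ′ as above and ω := K.ω)`.
* `ne5_of_record_restrict_loc_kernel_eval` — THE FULLY LOCAL FORM: leaf-09's `B13StepEndOn.ne5_of_record_restrict_loc` (E1 on the
  record sub-slot `restrict S M hMA hMB` with the termwise W2 data PER DOMAIN — `TermBoundLoc`∕`TermBudgetLoc`, owner R21 ∕ R27) with the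
  same three insertion binders discharged PER ENTRY; conclusion LITERALLY `NE5 (outA S E₀ cB) (outB S E₀ cB) W κ θ′ C₅`; no displayed
  constant is a global (volume-extensive) sum any more.
* `uniform_ne5_of_record_kernel_eval` — the same through leaf-10's `B13StepEndArithmetic.uniform_ne5_of_record`: L10∕L11 ELIMINATED into
  the two strict size inequalities, ONE `C₅` for EVERY pair of runs `R`, slot package `S`, kernel datum `K` with `S.D = K.toInsDatum`,
  `K.ω = ω`, window and roomy class (`∃ C₅, ∀ R S K W …`).
So, for kernel-read slot packages on a sup-normed table space, the E1 route's insertion-side inputs are the PER-ENTRY shapes of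
`B13HistInsertionLoc` (constants `cA`, `cB`, `δv` read per entry — owner finding R22) plus the base rate; what stays displayed is
unchanged in kind (transport reading, L05∕L06, row NE2's entry rate, termwise W2, rooms, sizes) — NOT NE5 proved.
0 sorry; 0 new definitions; axioms ⊆ {propext, Classical.choice, Quot.sound}.
-/

noncomputable section

open scoped BigOperators

namespace Summit.QuantumFields.BalabanUV.T4Continuum.B13StepEndKernelLoc

open Literature.MathematicalPhysics.QuantumFieldTheory.Balaban1983to89
open Literature.MathematicalPhysics.QuantumFieldTheory.Balaban1983to89.T4OutputRate (Carriers Functional DecayBound NE5)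
open Literature.MathematicalPhysics.QuantumFieldTheory.Balaban1983to89.T4InputCauchyRateData (StepModel)
open Literature.MathematicalPhysics.QuantumFieldTheory.Balaban1983to89.T4InputCauchyRateSpecies (ballClass)
open Literature.MathematicalPhysics.QuantumFieldTheory.Balaban1983to89.T4InputCauchyRateTermwise
open Summit.QuantumFields.BalabanUV.T4Continuum.B13Carriers (TwoRuns)
open Summit.QuantumFields.BalabanUV.T4Continuum.B13OpDatum (OpDatum)
open Summit.QuantumFields.BalabanUV.T4Continuum.B13OpDatumJunctions (opOf RawBounded WeightedEntrywiseRate)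
open Summit.QuantumFields.BalabanUV.T4Continuum.B13StepTermLabels (TermIdx InnerLabel)
open Summit.QuantumFields.BalabanUV.T4Continuum.B13StepTermFamily (term)
open Summit.QuantumFields.BalabanUV.T4Continuum.B13InnerData (Bnd)
open Summit.QuantumFields.BalabanUV.T4Continuum.B13Base (selfCtr)
open Summit.QuantumFields.BalabanUV.T4Continuum.B13Represents (Assembly)
open Summit.QuantumFields.BalabanUV.T4Continuum.B13StepEnd (ne5_of_assembly)
open Summit.QuantumFields.BalabanUV.T4Continuum.B13StepEndArithmetic (uniform_ne5_of_record)
open Summit.QuantumFields.BalabanUV.T4Continuum.B13StepOfRecord (Slots assembly step outA outB)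
open Summit.QuantumFields.BalabanUV.T4Continuum.B13StepOfRecordSub (restrict assemblyOn)
open Summit.QuantumFields.BalabanUV.T4Continuum.OutputRateTermwiseLoc (TermBoundLoc TermBudgetLoc)
open Summit.QuantumFields.BalabanUV.T4Continuum.B13StepEndOn (ne5_of_record_restrict_loc)
open Summit.QuantumFields.BalabanUV.T4Continuum.InsertionLinearRate (LinearPair.BaseRate)
open Summit.QuantumFields.BalabanUV.T4Continuum.InsertionLinearClassLoc (norming_evalCLM)
open Summit.QuantumFields.BalabanUV.T4Continuum.B13HistInsertion (KernelDatum)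
open Summit.QuantumFields.BalabanUV.T4Continuum.B13HistInsertionRate.KernelDatum (linB)
open Summit.QuantumFields.BalabanUV.T4Continuum.B13HistInsertionLoc.KernelDatum

variable {𝔾 : Type} [GaugeGroup 𝔾] {R : TwoRuns 𝔾} {E IOp : Type*} {α : Type*} [TopologicalSpace α]

/-! ## §1 The three insertion binders of E1 at the record, discharged from per-entry kernel data -/

section Binders

variable (S : Slots R E IOp (BoundedContinuousFunction α ℂ)) (K : KernelDatum R.carriers IOp (BoundedContinuousFunction α ℂ))
  (hD : S.D = K.toInsDatum) (E₀ cB : ℝ)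

include hD

/-- [folklore] The age damping of the assembly of record is the kernel datum's (`S.D = K.toInsDatum`). -/
theorem assembly_D_ω : (assembly S).D.ω = K.ω := by
  show S.D.ω = K.ω
  rw [hD]; rfl

/-- [folklore] Run A of the step model of record READS the kernel datum (`step_insA` + `S.D = K.toInsDatum`). -/
theorem readsA_step (W : Set (ℕ → ℝ)) : K.toInsDatum.ReadsA (step S E₀ cB) W := fun k g _ U t => by
  show S.D.insA g U k t = _
  rw [hD]

/-- [folklore] Run B of the step model of record READS the kernel datum. -/
theorem readsB_step (W : Set (ℕ → ℝ)) : K.toInsDatum.ReadsB (step S E₀ cB) W := fun k g _ U t => by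
  show S.D.insB g U k t = _
  rw [hD]

variable {S K E₀ cB}

/-- [folklore] **`hbA` OF E1 PER ENTRY**: run A's slice budget `S.D.SliceBudget (step S E₀ cB) W κ cA` from the per-entry kernel budget
`KerBudgetLoc K (step S E₀ cB) W κ cA evalCLM` (`sliceBudget_of_kerBudgetLoc norming_evalCLM`). -/
theorem sliceBudgetA_of_kerBudget_eval {W : Set (ℕ → ℝ)} {κ cA : ℝ}
    (hkA : KerBudgetLoc K (step S E₀ cB) W κ cA fun e : α => BoundedContinuousFunction.evalCLM ℂ e) (hcA : 0 ≤ cA) :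
    S.D.SliceBudget (step S E₀ cB) W κ cA := by
  rw [hD]
  exact sliceBudget_of_kerBudgetLoc norming_evalCLM hkA hcA

/-- [folklore] **`hbB` OF E1 PER ENTRY**: run B's slice budget `(assembly S).SliceBudgetB W κ cB` (the input of leaf L03 on the
assembled model) from the per-entry kernel budget `KerBudgetBLoc K (step S E₀ cB) W κ cB evalCLM` (`norm_sliceB_le_of_kerBudgetBLoc
norming_evalCLM`; `(step S E₀ cB).rHist = S.rHist` definitionally). -/
theorem sliceBudgetB_of_kerBudgetB_eval {W : Set (ℕ → ℝ)} {κ cB : ℝ}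
    (hkB : KerBudgetBLoc K (step S E₀ cB) W κ cB fun e : α => BoundedContinuousFunction.evalCLM ℂ e) (hcB : 0 ≤ cB) :
    (assembly S).SliceBudgetB W κ cB := by
  intro k g hg U j T t hj hT _ hbd
  show ‖S.D.slice k j (S.D.insOpB g U k) t‖ ≤ (step S E₀ cB).rHist k * (cB * T)
  rw [hD]
  exact norm_sliceB_le_of_kerBudgetBLoc norming_evalCLM hkB hcB k hg U hj hT hbd

/-- [folklore] **W4 OF E1 PER ENTRY**: `(step S E₀ cB).InsertionRate W κ E₀ (δb + E₀·(δv(1 − ω)⁻¹)) θ` from the displayed NE2-TYPE base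
rate and the per-entry kernel rate (`insertionRate_of_kernelRates_eval`, readings by `readsA_step`∕`readsB_step`). -/
theorem insertionRate_step_of_kernelRates_eval {W : Set (ℕ → ℝ)} {κ δb δv θ : ℝ}
    (hbase : LinearPair.BaseRate K.linA (linB K) (step S E₀ cB) W δb θ)
    (hkr : KerRateLoc K (step S E₀ cB) W κ δv θ fun e : α => BoundedContinuousFunction.evalCLM ℂ e)
    (hω : 0 ≤ K.ω) (hω1 : K.ω < 1) (hδv : 0 ≤ δv) (hθ : 0 ≤ θ) (hE₀ : 0 ≤ E₀) :
    (step S E₀ cB).InsertionRate W κ E₀ (δb + E₀ * (δv * (1 - K.ω)⁻¹)) θ :=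
  insertionRate_of_kernelRates_eval (readsA_step S K hD E₀ cB W) (readsB_step S K hD E₀ cB W) hbase hkr hω hω1 hδv hθ hE₀

end Binders

/-! ## §2 E1 at the record for kernel-read slot packages -/

section End

variable {S : Slots R E IOp (BoundedContinuousFunction α ℂ)} {K : KernelDatum R.carriers IOp (BoundedContinuousFunction α ℂ)}

/-- [folklore] **E1 OF RECORD, KERNEL-READ PER ENTRY.**  For a slot package `S` on a sup-normed table space whose insertion datum is the
finite-rank kernel datum `K` (`S.D = K.toInsDatum`): the END face of record `B13StepEnd.ne5_of_assembly (assembly S)` with its three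
insertion binders DISCHARGED from per-entry kernel data — `hbA` ⟸ `KerBudgetLoc … cA evalCLM`, `hbB` ⟸ `KerBudgetBLoc … cB evalCLM`, W4 ⟸
`BaseRate … δb θ ∧ KerRateLoc … δv θ evalCLM` (W4 constant `δ′ = δb + E₀·δv(1 − ω)⁻¹`, `ω = K.ω`) —, every other binder VERBATIM:
transport reading; L05∕L06 levels; `RawBounded` ×2 + row NE2's `WeightedEntrywiseRate … c₁ θ^k` + floor `r₀` (W1); termwise W2 data
`TermBound`∕`TermBudget`∕`TermLineAnalytic` on `ballClass (selfCtr raw histRef) ROp RHist`; rooms; numerics incl. L10 (`k₀`, `B`) and L11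
(`ρ₀`).  Conclusion LITERALLY `NE5 (outA S E₀ cB) (outB S E₀ cB) W κ θ′ C₅` with E1's constant.  NOT NE5 proved — an implication. -/
theorem ne5_of_record_kernel_eval (hD : S.D = K.toInsDatum) {W : Set (ℕ → ℝ)} {ROp RHist : ℕ → ℝ}
    {a : ℕ → TermIdx R.carriers.Dom (Bnd R) → ℝ} {κ G EA₀ E₀ E₁ cA cB c₁ r₀ δb δv θ θ' ρ₀ B : ℝ} {k₀ : ℕ}
    (hT : (assembly S).TransportReads W)
    (hkB : KerBudgetBLoc K (step S E₀ cB) W κ cB fun e : α => BoundedContinuousFunction.evalCLM ℂ e)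
    (hkA : KerBudgetLoc K (step S E₀ cB) W κ cA fun e : α => BoundedContinuousFunction.evalCLM ℂ e)
    (hdA : DecayBound (outA S E₀ cB) W EA₀ κ) (hdB : DecayBound (outB S E₀ cB) W E₀ κ)
    (hRA : RawBounded S.F (assembly S).rawAt W) (hRB : RawBounded S.F S.rawB W)
    (hwer : WeightedEntrywiseRate S.F (assembly S).rawAt S.rawB W c₁ fun k => θ ^ k) (hfl : ∀ k, r₀ ≤ S.rOp k)
    (hbase : LinearPair.BaseRate K.linA (linB K) (step S E₀ cB) W δb θ)
    (hkr : KerRateLoc K (step S E₀ cB) W κ δv θ fun e : α => BoundedContinuousFunction.evalCLM ℂ e)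
    (hbd : TermBound (ballClass (selfCtr (assembly S).raw (assembly S).histRef) ROp RHist)
      (term (assembly S).𝒯 (assembly S).inc S.act) W κ a)
    (hbud : TermBudget a G)
    (hline : TermLineAnalytic (ballClass (selfCtr (assembly S).raw (assembly S).histRef) ROp RHist)
      (term (assembly S).𝒯 (assembly S).inc S.act) W)
    (hOp : ∀ k, S.rOp k ≤ ROp k) (hHist : ∀ k, (assembly S).bHist E₀ cB k + S.rHist k ≤ RHist k)
    (hE₀ : 0 ≤ E₀) (hE₁ : 0 < E₁) (hG : 0 ≤ G) (hcA : 0 ≤ cA) (hcB : 0 ≤ cB) (hc₁ : 0 ≤ c₁) (hr₀ : 0 < r₀) (hδb : 0 ≤ δb)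
    (hδv : 0 ≤ δv) (hθ : 0 ≤ θ) (hθθ' : θ ≤ θ') (hθ'1 : θ' ≤ 1) (hω : 0 < K.ω) (hω1 : K.ω < 1) (hρ₀ : ρ₀ < 1)
    (hnear : (c₁ / r₀ + (δb + E₀ * (δv * (1 - K.ω)⁻¹))) * θ ^ k₀ + cA * (EA₀ + E₀) / (1 - K.ω) ≤ ρ₀) (hB : 0 ≤ B)
    (hfirst : ∀ k < k₀, EA₀ + E₀ ≤ B * θ ^ k) (hsmall : K.ω + G / (1 - ρ₀) * cA < θ') :
    NE5 (outA S E₀ cB) (outB S E₀ cB) W κ θ'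
      ((G / (1 - ρ₀) * (c₁ / r₀) + G / (1 - ρ₀) * (δb + E₀ * (δv * (1 - K.ω)⁻¹)) + B) * (θ' - K.ω) /
        (θ' - (K.ω + G / (1 - ρ₀) * cA))) := by
  have hωD : (assembly S).D.ω = K.ω := assembly_D_ω S K hD
  have h := ne5_of_assembly (assembly S) hT (sliceBudgetB_of_kerBudgetB_eval hD hkB hcB)
    (sliceBudgetA_of_kerBudget_eval hD hkA hcA) hdA hdB hRA hRB hwer hfl
    (insertionRate_step_of_kernelRates_eval hD hbase hkr hω.le hω1 hδv hθ hE₀) hbd hbud hline hOp hHist hE₀ hE₁ hG hcA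
    hcB hc₁ hr₀ (add_nonneg hδb (mul_nonneg hE₀ (mul_nonneg hδv (inv_nonneg.2 (sub_nonneg.2 hω1.le))))) hθ hθθ' hθ'1
    (hωD ▸ hω) (hωD ▸ hω1) hρ₀ (by rw [hωD]; exact hnear) hB hfirst (by rw [hωD]; exact hsmall)
  rw [hωD] at h
  exact h

/-- [folklore] **E1 OF RECORD, KERNEL-READ PER ENTRY, WITH A CONSTANT UNIFORM IN THE PAIR OF RUNS** (leaf-10's
`B13StepEndArithmetic.uniform_ne5_of_record` — L10∕L11 eliminated into `cA(EA₀ + E₀) < 1 − ω` and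
`ω + G·cA·(1 − ω)∕(1 − ω − cA(EA₀ + E₀)) < θ′` — with the three insertion binders discharged as in `ne5_of_record_kernel_eval`).  Fix
the displayed SIZES `κ, G, EA₀, E₀, cA, cB, c₁, r₀, δb, δv, θ, θ′, ω`; then ONE `C₅` serves EVERY pair of runs `R`, every slot package
`S` on a sup-normed table space and kernel datum `K` with `S.D = K.toInsDatum`, `K.ω = ω`, every window and roomy class.  NOT NE5
proved — an implication from displayed binders; the η-uniformity is the quantifier order `∃ C₅, ∀ R S K W …`. -/
theorem uniform_ne5_of_record_kernel_eval {κ G EA₀ E₀ cA cB c₁ r₀ δb δv θ θ' ω : ℝ}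
    (hE₀ : 0 ≤ E₀) (hG : 0 ≤ G) (hcA : 0 ≤ cA) (hcB : 0 ≤ cB) (hc₁ : 0 ≤ c₁) (hr₀ : 0 < r₀) (hδb : 0 ≤ δb) (hδv : 0 ≤ δv)
    (hθ0 : 0 < θ) (hθ1 : θ < 1) (hθθ' : θ ≤ θ') (hθ'1 : θ' ≤ 1) (hω : 0 < ω) (hω1 : ω < 1)
    (hh : cA * (EA₀ + E₀) < 1 - ω) (hsmall : ω + G * cA * (1 - ω) / (1 - ω - cA * (EA₀ + E₀)) < θ') :
    ∃ C₅ : ℝ, ∀ {𝔾 : Type} [GaugeGroup 𝔾] {R : TwoRuns 𝔾} {E IOp : Type*} {α : Type*} [TopologicalSpace α]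
      (S : Slots R E IOp (BoundedContinuousFunction α ℂ)) (K : KernelDatum R.carriers IOp (BoundedContinuousFunction α ℂ))
      {W : Set (ℕ → ℝ)} {ROp RHist : ℕ → ℝ} {a : ℕ → TermIdx R.carriers.Dom (Bnd R) → ℝ},
      S.D = K.toInsDatum → K.ω = ω →
      (assembly S).TransportReads W →
      (KerBudgetBLoc K (step S E₀ cB) W κ cB fun e : α => BoundedContinuousFunction.evalCLM ℂ e) →
      (KerBudgetLoc K (step S E₀ cB) W κ cA fun e : α => BoundedContinuousFunction.evalCLM ℂ e) →
      DecayBound (outA S E₀ cB) W EA₀ κ → DecayBound (outB S E₀ cB) W E₀ κ →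
      RawBounded S.F (assembly S).rawAt W → RawBounded S.F S.rawB W →
      WeightedEntrywiseRate S.F (assembly S).rawAt S.rawB W c₁ (fun k => θ ^ k) → (∀ k, r₀ ≤ S.rOp k) →
      LinearPair.BaseRate K.linA (linB K) (step S E₀ cB) W δb θ →
      (KerRateLoc K (step S E₀ cB) W κ δv θ fun e : α => BoundedContinuousFunction.evalCLM ℂ e) →
      TermBound (ballClass (selfCtr (assembly S).raw (assembly S).histRef) ROp RHist)
        (term (assembly S).𝒯 (assembly S).inc S.act) W κ a →
      TermBudget a G →
      TermLineAnalytic (ballClass (selfCtr (assembly S).raw (assembly S).histRef) ROp RHist)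
        (term (assembly S).𝒯 (assembly S).inc S.act) W →
      (∀ k, S.rOp k ≤ ROp k) → (∀ k, (assembly S).bHist E₀ cB k + S.rHist k ≤ RHist k) →
      NE5 (outA S E₀ cB) (outB S E₀ cB) W κ θ' C₅ := by
  have hδ' : 0 ≤ δb + E₀ * (δv * (1 - ω)⁻¹) :=
    add_nonneg hδb (mul_nonneg hE₀ (mul_nonneg hδv (inv_nonneg.2 (sub_nonneg.2 hω1.le))))
  obtain ⟨C₅, h⟩ := uniform_ne5_of_record (κ := κ) (c₁ := c₁) (cB := cB) hE₀ hG hcA hcB hc₁ hr₀ hδ' hθ0 hθ1 hθθ' hθ'1 hω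
    hω1 hh hsmall
  refine ⟨C₅, ?_⟩
  intro 𝔾 _ R E IOp α _ S K W ROp RHist a hD hKω hT hkB hkA hdA hdB hRA hRB hwer hfl hbase hkr hbd hbud hline hOp hHist
  have hSω : S.D.ω = ω := by rw [hD, ← hKω]; rfl
  have hins : (step S E₀ cB).InsertionRate W κ E₀ (δb + E₀ * (δv * (1 - ω)⁻¹)) θ := by
    rw [← hKω]
    exact insertionRate_step_of_kernelRates_eval hD hbase hkr (hKω ▸ hω).le (hKω ▸ hω1) hδv hθ0.le hE₀
  exact h S hSω hT (sliceBudgetB_of_kerBudgetB_eval hD hkB hcB) (sliceBudgetA_of_kerBudget_eval hD hkA hcA) hdA hdB hRA hRB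
    hwer hfl hins hbd hbud hline hOp hHist

/-- [folklore] **E1 OF RECORD WITH EVERY DISPLAYED BUDGET LOCAL — per-DOMAIN termwise (owner R21, leaf-09's `B13StepEndOn.ne5_of_record_restrict_loc`,
R27) × per-ENTRY insertion (owner R22, this lineage's `B13HistInsertionLoc`, R26).**  For a slot package `S` on a sup-normed table space
with `S.D = K.toInsDatum` and a sub-slot `M ≤ OpDatum E` holding both runs' operator data of record (`hMA`∕`hMB`; of record `↥measOp`,
R20): leaf-09's END on `restrict S M hMA hMB` (termwise W2 data `TermBoundLoc`∕`TermBudgetLoc`∕`TermLineAnalytic` displayed PER DOMAIN on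
the sub-slot class; W1 produced from the record's raw suppliers + row NE2's weighted entrywise rate) with its three insertion binders
`hbA`∕`hbB`∕`hins` DISCHARGED from the PER-ENTRY kernel data `KerBudgetLoc … cA evalCLM` ∕ `KerBudgetBLoc … cB evalCLM` ∕ `BaseRate … δb θ ∧
KerRateLoc … δv θ evalCLM` (§1).  Conclusion LITERALLY `NE5 (outA S E₀ cB) (outB S E₀ cB) W κ θ′ C₅` with E1's constant at
`δ′ = δb + E₀·δv(1 − ω)⁻¹`, `ω = K.ω`.  What stays displayed: transport reading, L05∕L06, `RawBounded` ×2 + `WeightedEntrywiseRate` (row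
NE2) + floor, `BaseRate` (NE2-type), the per-domain termwise W2 data, rooms, numerics — NOT NE5 proved; no constant in the list is a
global (volume-extensive) sum any more. -/
theorem ne5_of_record_restrict_loc_kernel_eval (hD : S.D = K.toInsDatum) (M : Submodule ℂ (OpDatum E))
    (hMA : ∀ g V k, opOf S.F S.rawA g V k ∈ M) (hMB : ∀ g U k, opOf S.F S.rawB g U k ∈ M) {E₀ cB : ℝ}
    {W : Set (ℕ → ℝ)} {ROp RHist : ℕ → ℝ} {a : ℕ → TermIdx R.carriers.Dom (Bnd R) → R.carriers.Dom → ℝ}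
    {κ G EA₀ E₁ cA c₁ r₀ δb δv θ θ' ρ₀ B : ℝ} {k₀ : ℕ}
    (hT : (assembly S).TransportReads W)
    (hkB : KerBudgetBLoc K (step S E₀ cB) W κ cB fun e : α => BoundedContinuousFunction.evalCLM ℂ e)
    (hkA : KerBudgetLoc K (step S E₀ cB) W κ cA fun e : α => BoundedContinuousFunction.evalCLM ℂ e)
    (hdA : DecayBound (outA S E₀ cB) W EA₀ κ) (hdB : DecayBound (outB S E₀ cB) W E₀ κ)
    (hRA : RawBounded S.F (assembly S).rawAt W) (hRB : RawBounded S.F S.rawB W)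
    (hwer : WeightedEntrywiseRate S.F (assembly S).rawAt S.rawB W c₁ fun k => θ ^ k) (hfl : ∀ k, r₀ ≤ S.rOp k)
    (hbase : LinearPair.BaseRate K.linA (linB K) (step S E₀ cB) W δb θ)
    (hkr : KerRateLoc K (step S E₀ cB) W κ δv θ fun e : α => BoundedContinuousFunction.evalCLM ℂ e)
    (hbd : TermBoundLoc (ballClass (selfCtr (assemblyOn (restrict S M hMA hMB)).raw (assemblyOn (restrict S M hMA hMB)).histRef)
      ROp RHist) (term (assemblyOn (restrict S M hMA hMB)).𝒯 (assemblyOn (restrict S M hMA hMB)).inc (restrict S M hMA hMB).act) W κ a)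
    (hbud : TermBudgetLoc a G)
    (hline : TermLineAnalytic (ballClass (selfCtr (assemblyOn (restrict S M hMA hMB)).raw
      (assemblyOn (restrict S M hMA hMB)).histRef) ROp RHist)
      (term (assemblyOn (restrict S M hMA hMB)).𝒯 (assemblyOn (restrict S M hMA hMB)).inc (restrict S M hMA hMB).act) W)
    (hOp : ∀ k, S.rOp k ≤ ROp k) (hHist : ∀ k, (assembly S).bHist E₀ cB k + S.rHist k ≤ RHist k)
    (hE₀ : 0 ≤ E₀) (hE₁ : 0 < E₁) (hG : 0 ≤ G) (hcA : 0 ≤ cA) (hcB : 0 ≤ cB) (hc₁ : 0 ≤ c₁) (hr₀ : 0 < r₀) (hδb : 0 ≤ δb)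
    (hδv : 0 ≤ δv) (hθ : 0 ≤ θ) (hθθ' : θ ≤ θ') (hθ'1 : θ' ≤ 1) (hω : 0 < K.ω) (hω1 : K.ω < 1) (hρ₀ : ρ₀ < 1)
    (hnear : (c₁ / r₀ + (δb + E₀ * (δv * (1 - K.ω)⁻¹))) * θ ^ k₀ + cA * (EA₀ + E₀) / (1 - K.ω) ≤ ρ₀) (hB : 0 ≤ B)
    (hfirst : ∀ k < k₀, EA₀ + E₀ ≤ B * θ ^ k) (hsmall : K.ω + G / (1 - ρ₀) * cA < θ') :
    NE5 (outA S E₀ cB) (outB S E₀ cB) W κ θ'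
      ((G / (1 - ρ₀) * (c₁ / r₀) + G / (1 - ρ₀) * (δb + E₀ * (δv * (1 - K.ω)⁻¹)) + B) * (θ' - K.ω) /
        (θ' - (K.ω + G / (1 - ρ₀) * cA))) := by
  have hSω : S.D.ω = K.ω := by rw [hD]; rfl
  have h := ne5_of_record_restrict_loc S M hMA hMB E₀ cB hT (sliceBudgetB_of_kerBudgetB_eval hD hkB hcB)
    (sliceBudgetA_of_kerBudget_eval hD hkA hcA) hdA hdB hRA hRB hwer hfl
    (insertionRate_step_of_kernelRates_eval hD hbase hkr hω.le hω1 hδv hθ hE₀) hbd hbud hline hOp hHist hE₀ hE₁ hG hcA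
    hcB hc₁ hr₀ (add_nonneg hδb (mul_nonneg hE₀ (mul_nonneg hδv (inv_nonneg.2 (sub_nonneg.2 hω1.le))))) hθ hθθ' hθ'1
    (hSω ▸ hω) (hSω ▸ hω1) hρ₀ (by rw [hSω]; exact hnear) hB hfirst (by rw [hSω]; exact hsmall)
  rw [hSω] at h
  exact h

end End

end Summit.QuantumFields.BalabanUV.T4Continuum.B13StepEndKernelLoc

end
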